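import Literature.MathematicalPhysics.QuantumFieldTheory.Balaban1983to89.B13ConditioningSandwich
import Literature.MathematicalPhysics.QuantumFieldTheory.Balaban1983to89.B13Eq111SDecoupling

/-!
# `Balaban1983to89.B13ConditioningDecoration` — T. Bałaban, *Renormalization group approach to lattice gauge field
theories. II. Cluster expansions*, Commun. Math. Phys. **116** (1988) 1–22 [Balaban1988RG2Cluster], p. 3 (after (1.7)),
(1.11) p. 5, p. 13, (2.5) p. 12, with [13] = [Balaban1985BackgroundPropagators] Thm 3.10 (3.107)–(3.108) p. 416:
PRINT's FORM OF THE s-DECORATED OPERATOR COMES FOR FREE — the s-decoration `Δ(s,u) = Σ_ω (∏_{Δ∈J(ω)} s(Δ))·T_ω(u)`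
(`B13Eq111SDecoupling.sDecorate`) of a σ-FREE joint walk expansion ([13] Thm 3.10 at complex backgrounds) whose walk
family carries a reversal compatible with the cube sets (`J(rev ω) = J(ω)`, `T_{rev ω} = T_ωᵀ`) IS a joint walk
expansion IN PRINT's FORM (s-monomial terms — by definition —, walk reversal) under print's dichotomy (P1)∕(P2) and the
through-clause; composed with the C-sandwich (`B13ConditioningSandwich`) this is the binder `hKexp` of the N10 record
junction for `K = Cᵀ·Δ(s,·)·C` FROM [13]'s σ-free expansion of the fluctuation operator

statement-level bookkeeping over published theorems with citation tags; kernel-checked compositions of tree theorems;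
nothing here is a claim about the Yang–Mills mass gap.

WHY (cell `pub-ymgap`, D-0062 Track A, node N10 = [B13]; seat `pub-ymgap-dag-n10-c` g3, module 24).  The chain of this
seat's modules 17–23 reduces N10's per-term NODE-A hypothesis to ONE print-form joint walk expansion of `CᵀΔC`, then of
`Δ = Δ_k(σ,𝐔,𝐉)`.  Print DEFINES `Δ_k(σ)` by decorating the σ-free walk expansion of [13] with the s-monomials of the
σ₀-cubes met (p. 3); the tree typed that construction (`B13Eq111SDecoupling.jointWalkExpansion_sDecorate_of_dichotomy`,
the cell's [B13] typer).  This file records that the decorated expansion is ALREADY in print's form (its terms are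
`sTerm J T₀ ω = (∏ s)·T_ω` by definition) and that a reversal of the σ-free family compatible with the cube sets survives
— so the expansion slot of the junction is, at the bottom, [13] Thm 3.10's σ-FREE expansion of the fluctuation operator
at complex backgrounds with a walk reversal, plus (1.11)'s cube-count geometry.  Positivity and `C`'s letters untouched.

WHAT THIS FILE PROVES (all `theorem`s; no `def`, no instance, no notation).
§1 `sTerm_eq_monomial_smul` (the decorated term IS an s-monomial times a σ-free operator, `rfl`-level),
   `sTerm_reversal` (a cube-compatible reversal of the σ-free family transposes the decorated terms).
§2 ★ `structuredExpansion_sDecorate` — σ-free expansion of `Δ₀(u)` through `X` (package `(R, ε, κ, K̄)`, rate `ρ`) with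
   a reversal `rev` (`T₀ (rev ω) u = (T₀ ω u)ᵀ`, `J (rev ω) = J ω`), a decoration `J` with print's dichotomy (P1)
   `m(ω) ≤ m₀ ∨ δ₁M·m(ω) ≤ ρ·D_ω` and restriction (P2) `κ₁ρ ≤ η·δ₁M` (`0 ≤ η ≤ ε`), and the through-clause ⟹
   `∃ W T SX A D ρ′ J′ T0 rev′`, a joint walk expansion of `sDecorate J T₀` through `X` at `(R, ε − η, κ, e^{κ₁m₀}K̄)` with
   s-monomial terms and a reversal — the structured datum modules 21∕23 consume.
§3 ★ `structuredExpansion_sandwich_sDecorate` — THE COMPOSITE: the same data + a real constant local `C` + a fibre bound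
   + a junction rate ⟹ the structured datum for `K = Cᵀ·(sDecorate J T₀)·C` at `(R, ε − η − 2μ, κ − 2μ, K̄_S)` —
   literally the `∃ …` of `Summit…N10AtRecord11B13WalksBlockMonomialHolo`'s binder `hKexp` for the print-defined
   conditioned operator, FROM [13]'s σ-free expansion.
HONEST FRAMING: kernel-level bookkeeping over the tree's (1.11) construction and product calculus; NOTHING of Bałaban's
`Δ_k` is constructed — whether HIS fluctuation operator's σ-FREE expansion ([13] Thm 3.10 for the operators determining
`Δ_k`, assembled by the (D4) programme `Gaps/D4Walk*`) exists k-uniformly at complex backgrounds with a walk reversal is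
NODE A ∕ in-edge N06 s4, the INPUT; count-neutral; NOT a discharge of N10; no `sorry`, no new named fact; standard
axioms; nothing continuum ∕ ℝ⁴ ∕ OS ∕ mass gap ∕ Clay.
-/

noncomputable section

namespace Literature.MathematicalPhysics.QuantumFieldTheory.Balaban1983to89.B13ConditioningDecoration

open Metric Set Finset
open scoped Matrix
open Literature.MathematicalPhysics.QuantumFieldTheory.Balaban1983to89
open Literature.MathematicalPhysics.QuantumFieldTheory.Balaban1983to89.B9SectDWalk (DomBy Through)
open Literature.MathematicalPhysics.QuantumFieldTheory.Balaban1983to89.B9Thm34Ext (toB6)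
open Literature.MathematicalPhysics.QuantumFieldTheory.Balaban1983to89.B9Thm37GlueTorus (torusGeom tdist1)
open Literature.MathematicalPhysics.QuantumFieldTheory.Balaban1983to89.TreeLengthTorus (TPt)
open Literature.MathematicalPhysics.QuantumFieldTheory.Balaban1983to89.B5TorusCover (UT)
open Literature.MathematicalPhysics.QuantumFieldTheory.Balaban1983to89.B13JointWalkExpansion (JointWalkExpansion)
open Literature.MathematicalPhysics.QuantumFieldTheory.Balaban1983to89.B13Eq111SDecoupling
  (sTerm sDecorate sTerm_apply jointWalkExpansion_sDecorate_of_dichotomy)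
open Literature.MathematicalPhysics.QuantumFieldTheory.Balaban1983to89.B13ConditioningSandwich
  (structuredExpansion_sandwich)

variable {d N' : ℕ} {ν : ℕ} {Nf : Fin ν → ℕ} [∀ i, NeZero (Nf i)]
variable {E : Type*} [NormedAddCommGroup E] [NormedSpace ℂ E]
variable {p : Type} {W : Type}

/-! ## §1. The decorated terms are s-monomials; a cube-compatible reversal transposes them -/

omit [NormedAddCommGroup E] [NormedSpace ℂ E] in
/-- **THE DECORATED TERM IS AN s-MONOMIAL TIMES A σ-FREE OPERATOR** (print p. 3, by definition of the decoration).
[cite: Balaban1988RG2Cluster, p.3 (after (1.7)), (1.11) p.5] -/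
theorem sTerm_eq_monomial_smul (J : W → Finset (TPt d N')) (T₀ : W → E → Matrix p p ℂ) (ω : W)
    (σ : TPt d N' → ℂ) (u : E) : sTerm J T₀ ω σ u = (∏ j ∈ J ω, σ j) • T₀ ω u := rfl

omit [NormedAddCommGroup E] [NormedSpace ℂ E] in
/-- **A CUBE-COMPATIBLE REVERSAL OF THE σ-FREE FAMILY TRANSPOSES THE DECORATED TERMS**: if `T₀ (rev ω) u = (T₀ ω u)ᵀ`
([13] (3.107): the reversed walk gives the transposed term) and `J (rev ω) = J ω` ((1.11): the cubes met by a walk do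
not see its orientation), then `sTerm (rev ω) = (sTerm ω)ᵀ`. [cite: Balaban1985BackgroundPropagators, (3.107) p.416; Balaban1988RG2Cluster, (1.11) p.5] -/
theorem sTerm_reversal (J : W → Finset (TPt d N')) (T₀ : W → E → Matrix p p ℂ) (rev : W ≃ W)
    (hrevT : ∀ ω u i j, T₀ (rev ω) u i j = T₀ ω u j i) (hrevJ : ∀ ω, J (rev ω) = J ω)
    (ω : W) (σ : TPt d N' → ℂ) (u : E) (i j : p) : sTerm J T₀ (rev ω) σ u i j = sTerm J T₀ ω σ u j i := by
  rw [sTerm_apply, sTerm_apply, hrevJ, hrevT]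

/-! ## §2. Print's form of the decorated expansion -/

section Decorated

variable {c : B13.Consts} {locF : p → UT Nf} {Δ₀ : E → Matrix p p ℂ} {X : Finset (UT Nf)}
variable {R ε kap Kbar ρ : ℝ} {T₀ : W → E → Matrix p p ℂ} {SX₀ : Set W} {A : W → ℝ} {D : W → UT Nf → UT Nf → ℝ}

/-- **THE s-DECORATED EXPANSION IN PRINT's FORM** — the structured datum of modules 21∕23 for `Δ(s,u) = sDecorate J T₀`
FROM the σ-free expansion of [13]: a σ-FREE joint walk expansion of `Δ₀(u) = Σ_ω T_ω(u)` through `X` (package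
`(R, ε, κ, K̄)`, rate `ρ`) whose walk family carries a cube-compatible reversal, a decoration `J` with print's dichotomy
(P1) and restriction (P2) at an absorbed rate `0 ≤ η ≤ ε` (`B13Eq111SDecoupling` §4) and the through-clause (a walk
picking up a parameter passes through `X`) give a joint walk expansion of the decorated kernel through `X` at
`(R, ε − η, κ, e^{κ₁m₀}K̄)` whose terms are s-MONOMIALS times σ-free operators (`sTerm`, by definition) and whose family
carries the SAME reversal. [cite: Balaban1988RG2Cluster, p.3 (after (1.7)), (1.11) p.5, p.13, p.15; Balaban1985BackgroundPropagators, (3.93) p.410, Thm 3.10 (3.107)–(3.108) p.416] -/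
theorem structuredExpansion_sDecorate (hκ₁ : 0 ≤ c.κ₁)
    (h₀ : JointWalkExpansion c locF locF (fun (_ : TPt d N' → ℂ) => Δ₀) X R ε kap Kbar
      (fun ω (_ : TPt d N' → ℂ) => T₀ ω) SX₀ A D ρ)
    (rev : W ≃ W) (hrevT : ∀ ω u i j, T₀ (rev ω) u i j = T₀ ω u j i)
    (J : W → Finset (TPt d N')) (hrevJ : ∀ ω, J (rev ω) = J ω)
    {m₀ : ℕ} {dM η : ℝ} (hdM : 0 < dM) (hη : 0 ≤ η) (hηε : η ≤ ε)
    (hdich : ∀ ω, (J ω).card ≤ m₀ ∨ ∀ a b, dM * (J ω).card ≤ ρ * D ω a b) (hR1 : c.κ₁ * ρ ≤ η * dM)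
    (hX : ∀ ω, (J ω).Nonempty → Through (toB6 (torusGeom Nf 0 0 0) 0 True) (D ω) (↑X : Set (UT Nf))) :
    ∃ (W' : Type) (T : W' → (TPt d N' → ℂ) → E → Matrix p p ℂ) (SX : Set W') (A' : W' → ℝ)
      (D' : W' → UT Nf → UT Nf → ℝ) (ρ' : ℝ) (J' : W' → Finset (TPt d N')) (T0 : W' → E → Matrix p p ℂ) (rev' : W' ≃ W'),
      JointWalkExpansion c locF locF (sDecorate J T₀) X R (ε - η) kap (Real.exp (c.κ₁ * m₀) * Kbar) T SX A' D' ρ' ∧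
        (∀ ω σ u, T ω σ u = (∏ j ∈ J' ω, σ j) • T0 ω u) ∧ (∀ ω σ u i j, T (rev' ω) σ u i j = T ω σ u j i) :=
  ⟨W, sTerm J T₀, _, _, D, ρ - η, J, T₀, rev,
    jointWalkExpansion_sDecorate_of_dichotomy hκ₁ h₀ J hdM hη hηε hdich hR1 hX,
    fun ω σ u => sTerm_eq_monomial_smul J T₀ ω σ u, fun ω σ u i j => sTerm_reversal J T₀ rev hrevT hrevJ ω σ u i j⟩

end Decorated

/-! ## §3. The composite: `K = Cᵀ·Δ(s,·)·C` in print's form from [13]'s σ-free expansion -/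

section Composite

variable {n : Type} [Fintype p]
variable {c : B13.Consts} {locF : p → UT Nf} {locN : n → UT Nf} {Δ₀ : E → Matrix p p ℂ} {X : Finset (UT Nf)}
variable {R ε kap Kbar ρ : ℝ} {T₀ : W → E → Matrix p p ℂ} {SX₀ : Set W} {A : W → ℝ} {D : W → UT Nf → UT Nf → ℝ}

/-- **THE STRUCTURED DATUM OF THE N10 JUNCTION FOR THE PRINT-DEFINED CONDITIONED OPERATOR `Cᵀ·Δ(s,·)·C` FROM [13]'s σ-FREE
EXPANSION OF THE FLUCTUATION OPERATOR**: the data of §2 (σ-free expansion of `Δ₀` through `X` with a cube-compatible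
reversal, walk distances dominating `d₁`; decoration `J` under (P1)∕(P2) at rate `η`, through-clause) + a real constant
local `C` (`|C k i| ≤ 1`, range `r_C`), a fibre bound `m_F` of the fine locations and a junction rate `μ > 0` with
`2μ ≤ ε − η`, `2μ ≤ κ`, `κ ≤ (ρ − η) − (ε − η)` give `∃ W T SX A D ρ′ J′ T0 rev′`: ONE joint walk expansion of
`(s,u) ↦ Cᵀ·(sDecorate J T₀ s u)·C` through `X` at `(R, ε − η − 2μ, κ − 2μ, K̄_S)` (the explicit constant of
`B13ConditioningSandwich.jointWalkExpansion_sandwich` at `K̄_Δ = e^{κ₁m₀}K̄`, `ρ₀ = ρ − η`) with s-MONOMIAL terms and a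
WALK REVERSAL — the binder `hKexp` of `Summit…N10AtRecord11B13WalksBlockMonomialHolo` for that operator.
[cite: Balaban1988RG2Cluster, p.3, (1.11) p.5, (2.5) p.12, p.13, p.15; Balaban1985BackgroundPropagators, (3.93) p.410, (3.107)–(3.108) p.416, p.422, Thm 3.12 p.423; Balaban1984PropagatorsII, Lemma 2.1 (2.61) p.234] -/
theorem structuredExpansion_sandwich_sDecorate (hκ₁ : 0 ≤ c.κ₁)
    (h₀ : JointWalkExpansion c locF locF (fun (_ : TPt d N' → ℂ) => Δ₀) X R ε kap Kbar
      (fun ω (_ : TPt d N' → ℂ) => T₀ ω) SX₀ A D ρ)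
    (hdom : ∀ ω, DomBy (toB6 (torusGeom Nf 0 0 0) 0 True) (D ω))
    (rev : W ≃ W) (hrevT : ∀ ω u i j, T₀ (rev ω) u i j = T₀ ω u j i)
    (J : W → Finset (TPt d N')) (hrevJ : ∀ ω, J (rev ω) = J ω)
    {m₀ : ℕ} {dM η : ℝ} (hdM : 0 < dM) (hη : 0 ≤ η) (hηε : η ≤ ε)
    (hdich : ∀ ω, (J ω).card ≤ m₀ ∨ ∀ a b, dM * (J ω).card ≤ ρ * D ω a b) (hR1 : c.κ₁ * ρ ≤ η * dM)
    (hX : ∀ ω, (J ω).Nonempty → Through (toB6 (torusGeom Nf 0 0 0) 0 True) (D ω) (↑X : Set (UT Nf)))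
    (C : Matrix p n ℝ) {rC : ℝ} (hCle : ∀ k i, |C k i| ≤ 1)
    (hCsupp : ∀ k i, C k i ≠ 0 → tdist1 Nf (locF k) (locN i) ≤ rC)
    {mF : ℕ} (hfibF : ∀ y : UT Nf, (Finset.univ.filter fun k => locF k = y).card ≤ mF)
    {μ : ℝ} (hμ : 0 < μ) (hμε : 2 * μ ≤ ε - η) (hμκ : 2 * μ ≤ kap) (hκε : kap ≤ (ρ - η) - (ε - η)) (hKbar : 0 ≤ Kbar) :
    ∃ (W' : Type) (T' : W' → (TPt d N' → ℂ) → E → Matrix n n ℂ) (SX' : Set W') (A' : W' → ℝ)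
      (D' : W' → UT Nf → UT Nf → ℝ) (ρ' : ℝ) (J' : W' → Finset (TPt d N')) (T0' : W' → E → Matrix n n ℂ) (rev' : W' ≃ W'),
      JointWalkExpansion c locN locN
          (fun σ u => (C.map (algebraMap ℝ ℂ))ᵀ * sDecorate J T₀ σ u * C.map (algebraMap ℝ ℂ)) X R
          (ε - η - μ - μ) (kap - μ - μ)
          ((mF * B6.c0 1 μ ^ ν) * ((mF * B6.c0 1 μ ^ ν) * Real.exp ((ρ - η) * rC) * (Real.exp (c.κ₁ * m₀) * Kbar)
            * B6.c0 1 μ ^ ν) * Real.exp ((ρ - η - μ) * rC) * B6.c0 1 μ ^ ν) T' SX' A' D' ρ' ∧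
        (∀ ω σ u, T' ω σ u = (∏ j ∈ J' ω, σ j) • T0' ω u) ∧ (∀ ω σ u i j, T' (rev' ω) σ u i j = T' ω σ u j i) :=
  structuredExpansion_sandwich C hCle hCsupp (jointWalkExpansion_sDecorate_of_dichotomy hκ₁ h₀ J hdM hη hηε hdich hR1 hX)
    hdom J T₀ (fun ω σ u => sTerm_eq_monomial_smul J T₀ ω σ u) rev
    (fun ω σ u i j => sTerm_reversal J T₀ rev hrevT hrevJ ω σ u i j) hfibF hμ hμε hμκ hκε
    (mul_nonneg (Real.exp_pos _).le hKbar)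

end Composite

end Literature.MathematicalPhysics.QuantumFieldTheory.Balaban1983to89.B13ConditioningDecoration

end
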